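import Summits.HodgeConjecture.HodgeCM.Model.LiuDictionaryTowerFixed
import HarnessLib

/-!
# Δ2 bridge — TOWER SEPARATION: a non-zero `U(V)(𝔸_f)`-stable subspace of the tower restricts non-trivially below every level

The orientation audit's consistency probe T2 (`d2bridge/wb-8/T2HodgeBlindReduction.lean`, `false_of_display_of_opposedTypes`) and the
referee's reading of ORIENTATION-MEMO §8 (pub-hodgecm2/INBOX, d2bridge-ref g28, 21:32Z, step (6)) take as an UNDISPLAYED input the
«J1-style tower separation law»

  `hsep : T.block μ ≠ ⊥ → ∀ K₀, ∃ K ≤ K₀, ∃ x ∈ T.block μ, x ∈ fixedBy (Kof K) T.H ∧ res K x ≠ 0`,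

asking that it be «named at file:line» before «family ⊢ False» is called tree-backed.  This file PROVES it for the tower dictionary of
record `HodgeCM.Model.LiuDictionary.ofTower …` (hence, by `rfl`, for the literal pin `liuDictionaryPin …`), from the ported tower API only:

* §1 `smul_mem_oscImage` / `smul_mem_block` — the blocks of ANY `LiuAlbaneseModuleDatum` are `ℂ[G]`-stable (they are sums of ranges of
  `ℂ[G]`-linear maps);
* §2 `exists_fixed_res_ne_zero` — for the tower `Tower … V`: a vector `y ≠ 0` of an `act`-stable `ℂ`-subspace `N` has, below any level `K₀`,
  a translate `x ∈ N` fixed by a level `K ≤ K₀` of the tower's index set with `res K x ≠ 0`.  Proof: `y = [c]`, `c ∈ H_Γ` a non-zero family of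
  component classes, `c g ≠ 0` for some index `g`; the Hecke translate `act g y = [translate g c]` has identity component `t_1^*(c g) ≠ 0`
  (`TowerInjective.trPull_one_injective`); restrict to `K := Γ.conj g ⊓ K₀` (`ofLevel_restrictLevel`, injective transitions again);
* §3 `hsep_ofTower` — the law above, VERBATIM in wb-8's shape, for `ofTower`.

KERNEL only; no definition, no cited fact, no `sorry`; explicit binders.  HC_CM is NOT proved; nothing here is a claim about Liu's objects.
-/

noncomputable section

namespace Summit.HodgeConjecture.CorCM.D2Bridge.TowerSeparation

open HodgeCM HodgeCM.Model HodgeCM.Model.LevelTranslate HodgeCM.Model.TowerLevel HodgeCM.Model.TowerCarrier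
open HodgeCM.Model.TowerInjective
open HodgeCM.Literature.Theta HodgeCM.Literature.Theta.LiuAlbaneseModuleDatum
open Literature.AlgebraicGeometry.HodgeTheory Literature.NumberTheory.Automorphic.PicardCM
open Literature.NumberTheory.Transcendental (Arapura2012_Cor_15_4_6)

universe u v

/-! ## §1 Blocks are `ℂ[G]`-stable -/

section Block

variable {G : Type u} [Group G] {Lvl : Type v} {Kof : Lvl → Subgroup G} (D : LiuAlbaneseModuleDatum G Kof)

/-- The `ω(t)`-isotypic sum `oscImage t` is stable under `ℂ[G]` (it is a sum of ranges of `ℂ[G]`-linear maps). [folklore] -/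
theorem smul_mem_oscImage (t : D.Triple) (a : MonoidAlgebra ℂ G) {x : D.H} (hx : x ∈ D.oscImage t) :
    a • x ∈ D.oscImage t := by
  refine Submodule.iSup_induction _ (motive := fun x => a • x ∈ D.oscImage t) hx ?_ ?_ ?_
  · intro ψ x hx
    obtain ⟨v, rfl⟩ := hx
    exact Submodule.mem_iSup_of_mem ψ ⟨a • v, by rw [map_smul]⟩
  · rw [smul_zero]; exact Submodule.zero_mem _
  · intro x y hx hy
    rw [smul_add]; exact Submodule.add_mem _ hx hy

/-- The `μ`-block is stable under `ℂ[G]`. [folklore] -/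
theorem smul_mem_block (μ : D.Char) (a : MonoidAlgebra ℂ G) {x : D.H} (hx : x ∈ D.block μ) :
    a • x ∈ D.block μ := by
  refine Submodule.iSup_induction _ (motive := fun x => a • x ∈ D.block μ) hx ?_ ?_ ?_
  · intro i x hx
    exact Submodule.mem_iSup_of_mem i (smul_mem_oscImage D ⟨μ, i⟩ a hx)
  · rw [smul_zero]; exact Submodule.zero_mem _
  · intro x y hx hy
    rw [smul_add]; exact Submodule.add_mem _ hx hy

end Block

/-! ## §2 Separation in the tower -/

section Tower

variable (hHD : exists_isReal_hodgeModel) (hI : hodgePQ_independent_of_hodgeModel)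
  (hU : BallQuotientUniformisedDatum) (h₃ : CMAbelianVarietyRealised) (hA : Arapura2012_Cor_15_4_6)
variable {L : CMField} {ι₁ : L →+* ℂ} {V : HermSpace3 L ι₁}

/-- A non-zero level family has a non-zero component. [folklore] -/
theorem exists_apply_ne_zero {Γ : Level V} {hΓ : Γ.BelowConjThree}
    {c : towerLevel hHD hI hU h₃ hA Γ hΓ} (hc : c ≠ 0) :
    ∃ g : V.adelicFin, (c : Π h, W hHD hI hU h₃ Γ hΓ h) g ≠ 0 := by
  by_contra hall
  simp only [ne_eq, not_exists, not_not] at hall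
  exact hc (Subtype.ext (funext hall))

/-- An injective transition pull-back does not kill a non-zero class. [folklore] -/
theorem trPull_one_ne_zero {Δ Δ' : Level V} (ht : TransCond ((1 : ↥(Urat V)) : GL (Fin 3) L) Δ' Δ)
    {v : Coh hHD hI hU h₃ Δ 1} (hv : v ≠ 0) : trPull hHD hI hU h₃ hA 1 Δ' Δ ht 1 v ≠ 0 := fun h0 =>
  hv (trPull_one_injective hHD hI hU h₃ hA ht 1 (h0.trans (map_zero _).symm))

/-- The identity component of the `g`-translate of a family is (two injective pull-backs of) its `g`-component. [folklore] -/
theorem res_translate_ne_zero {Γ : Level V} (hΓ : Γ.BelowConjThree) (c : towerLevel hHD hI hU h₃ hA Γ hΓ)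
    {g : V.adelicFin} (hcg : (c : Π h, W hHD hI hU h₃ Γ hΓ h) g ≠ 0) :
    (TowerLevel.translate hHD hI hU h₃ hA hΓ g c : Π h, W hHD hI hU h₃ (Γ.conj g hΓ) (hΓ.conj g) h) 1 ≠ 0 := by
  rw [translate_apply]
  refine trPull_one_ne_zero hHD hI hU h₃ hA (transCond_conj_conj hΓ g 1) ?_
  have key : ∀ (i : V.adelicFin) (e : i = g), (c : Π h, W hHD hI hU h₃ Γ hΓ h) i ≠ 0 := by
    intro i e; subst e; exact hcg
  exact key (1 * g) (one_mul g)

/-- **TOWER SEPARATION.**  Let `N` be a `ℂ`-subspace of the tower stable under the action `act g` of every `g ∈ U(V)(𝔸_f)`, and `y ∈ N`,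
`y ≠ 0`.  Then below every level `K₀` there is a level `K ≤ K₀` of the tower's index set and an `x ∈ N` fixed by `K.K` whose restriction to
the identity component `res K x` is non-zero.  (`x` is a Hecke translate of `y`.) [folklore] -/
theorem exists_fixed_res_ne_zero (N : Submodule ℂ (Tower hHD hI hU h₃ hA V))
    (hN : ∀ (g : V.adelicFin) (x : Tower hHD hI hU h₃ hA V), x ∈ N → act hHD hI hU h₃ hA g x ∈ N)
    {y : Tower hHD hI hU h₃ hA V} (hyN : y ∈ N) (hy : y ≠ 0) (K₀ : Level V) :
    ∃ K : Level V, K ≤ K₀ ∧ ∃ hK : K.BelowConjThree, ∃ x ∈ N,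
      (∀ k ∈ K.K, act hHD hI hU h₃ hA k x = x) ∧ TowerCarrier.res hHD hI hU h₃ hA K hK x ≠ 0 := by
  obtain ⟨Γ, hΓ, c, rfl⟩ := exists_ofLevel hHD hI hU h₃ hA y
  have hc : c ≠ 0 := fun h => hy (by rw [h, map_zero])
  obtain ⟨g, hcg⟩ := exists_apply_ne_zero hHD hI hU h₃ hA hc
  have hK₁ : (Γ.conj g hΓ).BelowConjThree := hΓ.conj g
  have hK : (Γ.conj g hΓ ⊓ K₀).BelowConjThree := hK₁.of_le inf_le_left
  have hx₁ : act hHD hI hU h₃ hA g (ofLevel hHD hI hU h₃ hA Γ hΓ c) =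
      ofLevel hHD hI hU h₃ hA (Γ.conj g hΓ ⊓ K₀) hK
        (restrictLevel hHD hI hU h₃ hA inf_le_left hK₁ hK (TowerLevel.translate hHD hI hU h₃ hA hΓ g c)) := by
    rw [act_ofLevel, ofLevel_restrictLevel]
  refine ⟨Γ.conj g hΓ ⊓ K₀, inf_le_right, hK, act hHD hI hU h₃ hA g (ofLevel hHD hI hU h₃ hA Γ hΓ c), hN g _ hyN, ?_, ?_⟩
  · intro k hk
    rw [hx₁]
    exact act_ofLevel_of_mem hHD hI hU h₃ hA hK hk _
  · rw [hx₁, TowerCarrier.res_ofLevel, res_apply, restrictLevel_apply]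
    exact trPull_one_ne_zero hHD hI hU h₃ hA (transCond_one_of_eq (Level.conj_one _ hK).symm)
      (trPull_one_ne_zero hHD hI hU h₃ hA (transCond_conj_of_le inf_le_left hK₁ hK 1)
        (res_translate_ne_zero hHD hI hU h₃ hA hΓ c hcg))

/-- The same, in the dictionary's currency: `fixedBy K.K` (`MonoidAlgebra.of k • x = x`) and `resTotal K`. [folklore] -/
theorem exists_fixedBy_resTotal_ne_zero (N : Submodule ℂ (Tower hHD hI hU h₃ hA V))
    (hN : ∀ (g : V.adelicFin) (x : Tower hHD hI hU h₃ hA V), x ∈ N → act hHD hI hU h₃ hA g x ∈ N)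
    (hN0 : N ≠ ⊥) (K₀ : Level V) :
    ∃ K : Level V, K ≤ K₀ ∧ ∃ x ∈ N,
      x ∈ fixedBy K.K (Tower hHD hI hU h₃ hA V) ∧ resTotal hHD hI hU h₃ hA K x ≠ 0 := by
  obtain ⟨y, hyN, hy⟩ := (Submodule.ne_bot_iff N).mp hN0
  obtain ⟨K, hK0, hK, x, hxN, hfix, hres⟩ := exists_fixed_res_ne_zero hHD hI hU h₃ hA N hN hyN hy K₀
  refine ⟨K, hK0, x, hxN, (mem_fixedBy K.K x).mpr fun k hk => ?_, ?_⟩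
  · rw [of_smul_eq_act]
    exact hfix k hk
  · rwa [resTotal_of hHD hI hU h₃ hA K hK]

end Tower

/-! ## §3 The law at the tower dictionary of record (wb-8's `hsep`, verbatim) -/

section Dictionary

variable (hHD : exists_isReal_hodgeModel) (hI : hodgePQ_independent_of_hodgeModel)
  (h₁ : BallQuotientUniformised) (h₃ : CMAbelianVarietyRealised) (hA : Arapura2012_Cor_15_4_6)
variable {L : CMField} {ι₁ : L →+* ℂ} (V : HermSpace3 L ι₁)
  (Char : Type) (Adm : Char → Type) (Ω : (μ : Char) → Adm μ → Type)
  [∀ μ a, AddCommGroup (Ω μ a)] [∀ μ a, Module ℂ (Ω μ a)] [∀ μ a, Module (adelicAlgebra V) (Ω μ a)]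
  [∀ μ a, IsScalarTower ℂ (adelicAlgebra V) (Ω μ a)] (PhiMu : Char → Prop) (adm : Char → LiuCMSide → Prop)

/-- The blocks of the tower dictionary are stable under the tower action `act g`. [folklore] -/
theorem act_mem_block_ofTower (μ : Char) (g : V.adelicFin)
    {x : (LiuDictionary.ofTower hHD hI h₁ h₃ hA V Char Adm Ω PhiMu adm).H}
    (hx : x ∈ (LiuDictionary.ofTower hHD hI h₁ h₃ hA V Char Adm Ω PhiMu adm).block μ) :
    act hHD hI (ballQuotientUniformisedDatum_of h₁) h₃ hA g x ∈
      (LiuDictionary.ofTower hHD hI h₁ h₃ hA V Char Adm Ω PhiMu adm).block μ := by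
  have h := smul_mem_block (LiuDictionary.ofTower hHD hI h₁ h₃ hA V Char Adm Ω PhiMu adm).toLiuAlbaneseModuleDatum μ
    (MonoidAlgebra.of ℂ (↥V.adelicFin) g) hx
  rwa [show (MonoidAlgebra.of ℂ (↥V.adelicFin) g) • x = act hHD hI (ballQuotientUniformisedDatum_of h₁) h₃ hA g x from
    of_smul_eq_act hHD hI (ballQuotientUniformisedDatum_of h₁) h₃ hA g x] at h

/-- **TOWER SEPARATION AT THE DICTIONARY OF RECORD** (`T := LiuDictionary.ofTower …`; the literal pin `liuDictionaryPin …` is an instance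
by `rfl`): a non-zero block has, below every level `K₀`, a `K`-fixed vector (`K ≤ K₀`) with non-zero identity-component restriction
`T.res K x`.  This is the `hsep` input of the T2 consistency probe, now a theorem. [folklore] -/
theorem hsep_ofTower (μ : Char)
    (hne : (LiuDictionary.ofTower hHD hI h₁ h₃ hA V Char Adm Ω PhiMu adm).block μ ≠ ⊥) (K₀ : Level V) :
    ∃ K : Level V, K ≤ K₀ ∧ ∃ x ∈ (LiuDictionary.ofTower hHD hI h₁ h₃ hA V Char Adm Ω PhiMu adm).block μ,
      x ∈ fixedBy K.K (LiuDictionary.ofTower hHD hI h₁ h₃ hA V Char Adm Ω PhiMu adm).H ∧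
        (LiuDictionary.ofTower hHD hI h₁ h₃ hA V Char Adm Ω PhiMu adm).res K x ≠ 0 :=
  exists_fixedBy_resTotal_ne_zero hHD hI (ballQuotientUniformisedDatum_of h₁) h₃ hA
    ((LiuDictionary.ofTower hHD hI h₁ h₃ hA V Char Adm Ω PhiMu adm).block μ)
    (fun g _ hx => act_mem_block_ofTower hHD hI h₁ h₃ hA V Char Adm Ω PhiMu adm μ g hx) hne K₀

/-- **Contrapositive, the form the consistency probe T2 consumes**: if below some level `K₀` every `K`-fixed vector of the `μ`-block restricts
to `0` on the identity component, then the `μ`-block is `⊥`. [folklore] -/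
theorem block_eq_bot_of_res_eq_zero (μ : Char) (K₀ : Level V)
    (h0 : ∀ K : Level V, K ≤ K₀ → ∀ x ∈ (LiuDictionary.ofTower hHD hI h₁ h₃ hA V Char Adm Ω PhiMu adm).block μ,
      x ∈ fixedBy K.K (LiuDictionary.ofTower hHD hI h₁ h₃ hA V Char Adm Ω PhiMu adm).H →
        (LiuDictionary.ofTower hHD hI h₁ h₃ hA V Char Adm Ω PhiMu adm).res K x = 0) :
    (LiuDictionary.ofTower hHD hI h₁ h₃ hA V Char Adm Ω PhiMu adm).block μ = ⊥ := by
  by_contra hne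
  obtain ⟨K, hK, x, hx, hfix, hres⟩ := hsep_ofTower hHD hI h₁ h₃ hA V Char Adm Ω PhiMu adm μ hne K₀
  exact hres (h0 K hK x hx hfix)

end Dictionary

end Summit.HodgeConjecture.CorCM.D2Bridge.TowerSeparation

end
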